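import Summits.ResolutionOfSingularities.ResolutionOfSingularities.Theorems.HomologicalConductorNoZenoSplitCountLocalBaseChange
import Summits.ResolutionOfSingularities.ResolutionOfSingularities.Theorems.HomologicalConductorNoZenoSplitCountDescent
import Summits.ResolutionOfSingularities.ResolutionOfSingularities.Theorems.HomologicalConductorNoZenoChartGermGalois
import Summits.ResolutionOfSingularities.ResolutionOfSingularities.Theorems.HomologicalConductorNoZenoMinimalityBaseChange
import Summits.ResolutionOfSingularities.ResolutionOfSingularities.Theorems.HomologicalConductorNoZenoSplitWeightFinite
import Summits.ResolutionOfSingularities.ResolutionOfSingularities.Theorems.HomologicalConductorNoZenoSplitDataThread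
import HarnessLib

/-!
# Crux `NoZenoR` (stmt-ResolutionOfSingularities-19943), slot `stub_L1wCoreF3`, seam3 — (seam3-INST)
# `N^s` DESCENDS ALONG THE CHART GERM: `HasSplitExcCurveCountLE D'_f m → HasSplitExcCurveCountLE D' m`

Route `ResolutionOfSingularities/HomologicalConductor`, crux chain W4.4.  OURS (cell res-hironaka; planner res-L0-w44-plan-1 DESK WORD 23 /
RULING (ρ53f) «(seam3-INST) → o5»; lead res-L0-w44-lead-1 SHAPE RULE 21:31:14Z: ∀-form over the chart prime `𝔮_f` with `hover`);
AI-written, weaker than expert review; nothing of the manuscript under review (Hironaka 2017) is used and no Theses declaration is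
asserted.  Def-free, `--supports 19943 --as helper`.  CONDITIONAL on the route's Literature named facts Lipman 1969 (4.1), (16.1)(ii),
(16.5), (27.3), (13.1) b), d) (binders `h41 h161 h165 h273 h131b h131d`, as in res-L0-w44-stub-2's BC-4).

ASSEMBLY of three landed bricks, for the chart germ `D' := R_𝔮 → D'_f := (k[R ∪ {β}])_{𝔮_f}` of `exists_chartGermData`
(`φ = algebraMap` of `fibreGermAlgebra`; local, flat, unramified, `𝔪 ↦ 𝔪`, `κ(D'_f)/κ(D')` finite separable, NOT finite):
* descent skeleton `hasSplitExcCurveCountLE_of_baseChange` (res-L1-type-o5, `…NoZenoSplitCountDescent`);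
* BC-4 `hBC4`: `isMinimalResolution_pullback_snd_of_tower` (res-L0-w44-stub-2, `…NoZenoMinimalityBaseChange`) over res-D-pv-039's
  Galois splitting germ of the chart germ `exists_galoisGerm_chart` (`…NoZenoChartGermGalois`);
* BC-2 `hBC2`: `splitExcCount_pullback_snd_local` (res-L1-type-o5, `…NoZenoSplitCountLocalBaseChange`: any local ring map with `𝔪 ↦ 𝔪` and
  finite separable residue extension; honest weights by `finiteDimensional_separableClosure_residueField`, res-L0-w44-stub-2 FW);
* `hmin`: Lipman (4.1) `Lipman1969_4_1.exists_isMinimalResolution_Spec`.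

* **`hasSplitExcCurveCountLE_chartGerm`** — the statement in the `locPrimeSubalgebra R 𝔮` spelling of `D'`;
* **`hasSplitExcCurveCountLE_chartGerm'`** — the same in `Sig.L1Core`'s spelling `locPrime R 𝔮` (same type, `rfl`-transport).

References: J. Lipman, Publ. Math. IHÉS 36 (1969), Theorem (4.1) (p. 204), Lemma (16.1) (p. 231), Proposition (16.5) (p. 235)
[`Lipman1969`].
-/

noncomputable section

-- single-problem summit: the doubled namespace component `ResolutionOfSingularities` is forced
set_option linter.dupNamespace false

namespace Summit.ResolutionOfSingularities.ResolutionOfSingularities.Theorems.NoZeno.ExcCount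

open CategoryTheory CategoryTheory.Limits AlgebraicGeometry IsLocalRing Polynomial
open Literature.AlgebraicGeometry.Resolution
open Summit.ResolutionOfSingularities.ResolutionOfSingularities.Theorems.NoZeno.SandwichCluster
open Parasite (locPrime isLocalRing_locPrime)
open Summit.ResolutionOfSingularities.ResolutionOfSingularities.Theorems.NoZeno.SplittingBase

variable {k K : Type} [Field k] [Field K] [Algebra k K]

set_option maxHeartbeats 400000 in
/-- **(seam3-INST) `N^s` descends along the chart germ.**  In the setting of `exists_chartGermData` (`D ≤ R ⊆ K`, `D` local, `R`
Noetherian normal with `Frac R = K`, `f ∈ D[X]` monic with `f_K` irreducible and `f̄` separable, `𝔮` a prime of `R` with `D' := R_𝔮`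
two-dimensional with a rational singularity), for EVERY prime `𝔮_f` of `k[R ∪ {β}]` over `𝔮` (`hover`):
`HasSplitExcCurveCountLE D'_f m → HasSplitExcCurveCountLE D' m`, `D'` spelled `locPrimeSubalgebra R 𝔮`.
(Conditional on Lipman (4.1), (16.1)(ii), (16.5), (27.3), (13.1) b), d).)
[this work; cite: Lipman1969, Theorem (4.1) (p. 204), Lemma (16.1) (p. 231), Proposition (16.5) (p. 235)] -/
theorem hasSplitExcCurveCountLE_chartGerm
    (h41 : Lipman1969_4_1.{0}) (h161 : Lipman1969_16_1_ii.{0}) (h165 : Lipman1969_16_5.{0})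
    (h273 : Lipman1969_27_3_rat.{0}) (h131b : Lipman1969_13_1_b_rat.{0}) (h131d : Lipman1969_13_1_d_rat.{0})
    (D R : Subalgebra k K) (hDR : D ≤ R) (f : (↥D)[X]) [Fact (Irreducible (f.map (algebraMap ↥D K)))]
    (𝔮 : Ideal ↥R) (h𝔮 : 𝔮.IsPrime) [IsLocalRing ↥D] [IsNoetherianRing ↥R] [IsIntegrallyClosed ↥R] [IsFractionRing ↥R K]
    (hf : f.Monic) (hsep : (f.map (residue ↥D)).Separable)
    (𝔮f : Ideal ↥(adjoinBeta R (f.map (algebraMap ↥D K)))) (h𝔮f : 𝔮f.IsPrime)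
    (hover : ∀ r : ↥R, toAdjoinBeta R (f.map (algebraMap ↥D K)) r ∈ 𝔮f ↔ r ∈ 𝔮)
    (h2 : ringKrullDim ↥(locPrimeSubalgebra R 𝔮 h𝔮) = 2) (hS : HasRationalSingularity ↥(locPrimeSubalgebra R 𝔮 h𝔮))
    {m : ℕ} (h : HasSplitExcCurveCountLE ↥(locPrime (adjoinBeta R (f.map (algebraMap ↥D K))) 𝔮f h𝔮f) m) :
    HasSplitExcCurveCountLE ↥(locPrimeSubalgebra R 𝔮 h𝔮) m := by
  haveI := isLocalRing_locPrime (adjoinBeta R (f.map (algebraMap ↥D K))) 𝔮f h𝔮f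
  letI instAlg := fibreGermAlgebra _ _ _ (chartPoly_map D R hDR f 𝔮 h𝔮) _
    (chartGerm_le D R hDR f 𝔮 h𝔮 𝔮f h𝔮f hover)
  have hu : IsUnit (AdjoinRoot.mk f (derivative f)) := isUnit_mk_derivative_of_separable_map hf hsep
  -- the local-étale bundle of the chart germ `D' → D'_f`
  obtain ⟨hlh, hN, hfl, -, -, hm, hsepres, hfinres, hdim, -⟩ := chartGerm_bundle D R hDR f 𝔮 h𝔮 𝔮f h𝔮f hover hf hu
  haveI := hlh
  haveI := hN
  haveI := hfl
  haveI := hsepres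
  haveI := hfinres
  have h2f : ringKrullDim ↥(locPrime (adjoinBeta R (f.map (algebraMap ↥D K))) 𝔮f h𝔮f) = 2 :=
    hdim.trans ((ringKrullDim_locPrimeSubalgebra R 𝔮 h𝔮).symm.trans h2)
  refine hasSplitExcCurveCountLE_of_baseChange h2 (Spec.map (CommRingCat.ofHom (algebraMap _ _)))
    (h41.exists_isMinimalResolution_Spec _ h2 hS) (fun ρ hρ => ?_) (fun ρ hρ => ?_) h
  · -- BC-4 over res-D-pv-039's Galois splitting germ of the chart germ
    obtain ⟨Ŝ, _, _, _, _, _, _, B, _, _, _, _, 𝔫, _, _, _, _, _, _, _, _, H, _, _, ρH, hBunr, hBft, hmax, hmf', hfin,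
      hgal, hsepf, hdimB, hres⟩ := exists_galoisGerm_chart D R hDR f 𝔮 h𝔮 hf hsep 𝔮f h𝔮f hover
    haveI := hBunr
    haveI := hBft
    haveI := hfin
    haveI := hgal
    haveI := hsepf
    exact isMinimalResolution_pullback_snd_of_tower ρ 𝔫.primeCompl ρH hres h41 h161 h165 h273 h131b h131d h2 h2f
      (hdimB.trans h2) hS hm hmf' hmax hρ _ rfl
  · -- BC-2 for the local map `D' → D'_f`
    haveI : IsProper ρ := hρ.isResolution.isProper
    exact splitExcCount_pullback_snd_local hm ρ
      ((excPoints_finite ρ).subset (hρ.isResolution.excCurvePoints_subset_excPoints h2))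
      fun η _ => finiteDimensional_separableClosure_residueField ρ η

/-- **(seam3-INST) in `Sig.L1Core`'s spelling `locPrime R 𝔮`** of the chart germ downstairs (same elements, same ring
structure as `locPrimeSubalgebra R 𝔮`). [this work; cite: Lipman1969, Theorem (4.1) (p. 204), Lemma (16.1) (p. 231)] -/
theorem hasSplitExcCurveCountLE_chartGerm'
    (h41 : Lipman1969_4_1.{0}) (h161 : Lipman1969_16_1_ii.{0}) (h165 : Lipman1969_16_5.{0})
    (h273 : Lipman1969_27_3_rat.{0}) (h131b : Lipman1969_13_1_b_rat.{0}) (h131d : Lipman1969_13_1_d_rat.{0})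
    (D R : Subalgebra k K) (hDR : D ≤ R) (f : (↥D)[X]) [Fact (Irreducible (f.map (algebraMap ↥D K)))]
    (𝔮 : Ideal ↥R) (h𝔮 : 𝔮.IsPrime) [IsLocalRing ↥D] [IsNoetherianRing ↥R] [IsIntegrallyClosed ↥R] [IsFractionRing ↥R K]
    (hf : f.Monic) (hsep : (f.map (residue ↥D)).Separable)
    (𝔮f : Ideal ↥(adjoinBeta R (f.map (algebraMap ↥D K)))) (h𝔮f : 𝔮f.IsPrime)
    (hover : ∀ r : ↥R, toAdjoinBeta R (f.map (algebraMap ↥D K)) r ∈ 𝔮f ↔ r ∈ 𝔮)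
    (h2 : ringKrullDim ↥(locPrime R 𝔮 h𝔮) = 2)
    (hS : haveI := isLocalRing_locPrime R 𝔮 h𝔮; HasRationalSingularity ↥(locPrime R 𝔮 h𝔮))
    {m : ℕ} (h : haveI := isLocalRing_locPrime (adjoinBeta R (f.map (algebraMap ↥D K))) 𝔮f h𝔮f
      HasSplitExcCurveCountLE ↥(locPrime (adjoinBeta R (f.map (algebraMap ↥D K))) 𝔮f h𝔮f) m) :
    haveI := isLocalRing_locPrime R 𝔮 h𝔮
    HasSplitExcCurveCountLE ↥(locPrime R 𝔮 h𝔮) m :=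
  hasSplitExcCurveCountLE_chartGerm h41 h161 h165 h273 h131b h131d D R hDR f 𝔮 h𝔮 hf hsep 𝔮f h𝔮f hover h2 hS h

end Summit.ResolutionOfSingularities.ResolutionOfSingularities.Theorems.NoZeno.ExcCount

end
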